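import Summits.BirchSwinnertonDyer.Rank1Residual.X11b.Three.GoodReductionSubgroupGaloisH1
import Literature.NumberTheory.EllipticCurves.UnramifiedFormalGroupH1Proofs
import Mathlib.RingTheory.Henselian
import Mathlib.RingTheory.AdicCompletion.Basic
import HarnessLib

/-!
# X11b at `p = 3` (team N8/O2), JET3-KUMMER (α), the formal-group half: the inputs of the
# successive approximation over an abstract complete unramified layer (discreteness, Hensel lift
# of the parameter `z`, completeness), in p1's `JetchevKummerAtP` dictionary

HONEST FRAMING (cell `b2b-bsdres`, run/shared/lean/b2b/bsd-rank1-residual/, verbatim in every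
file): the goal of the cell is to DELETE the COMBINATION-SHAPED residual classes of the
Birch–Swinnerton-Dyer formula for ALL analytic-rank `≤ 1` elliptic curves over `ℚ` — "full BSD
formula for every rank `≤ 1` curve in class `C`" assembled STRICTLY from published theorems — so
that the rank-`≤ 1` remainder becomes exactly the CONSTRUCTION-SHAPED classes, which are TYPED
(missing-input `Prop`s), NOT attempted. This is not "finishing BSD". Team N8/O2 = `x11b3`, seat
`b2b-bsdres-x11b3-p4`, LEAD DEAL #6 row R6-9 / A6.2 (S15 (i): the formal-group stub `h1ker` of
`GoodReductionSubgroupGaloisH1.hα_of_cyclic_of_halves`), part 6. THEOREMS ONLY: no definition, no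
named fact, no `sorry`; nothing is booked; `JET@p|N` NOT discharged.

## What

The tree's ABSTRACT successive approximation
`Literature.NumberTheory.EllipticCurves.FormalGroupChart.exists_map_sub_eq_of_sum_eq_zero`
(`UnramifiedFormalGroupH1Proofs`; Milne *ADT* I.3.8, proof — the identity component; Serre *Local
Fields* V §2, XIII §1) proves `H¹(⟨F⟩, E₁(K_n)) = 0` in cyclic form for a layer `K_n` of a valued
field `(L, w)`, GIVEN four inputs: (i) discreteness of `K_n` with a uniformiser from the base,
(ii) graded additive Hilbert 90, (iii) every small `z` is the parameter of a point of `E₁(K_n)`,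
(iv) completeness. This file supplies (i), (iii), (iv) (and the integrality instance) in p1's
dictionary — `X / F`, `L ⊇ F` with an abstract discrete valuation ring `R`, `Frac R = L`, an
`R`-model `W₀` of `X ⊗ L` — for a rank-one valuation `w : Valuation L ℝ≥0` whose valuation ring
is `R` (`hw : w.Integers R`; the layer is `K_n = L` itself, i.e. `⊤`):

* `isIntegral_integer_of_baseChange_eq` — `X ⊗ L` is `𝒪_w`-integral;
* `val_le_val_uniformizer_of_lt_one` — (i): `|x| < 1 ⇒ |x| ≤ |ϖ|` for a uniformiser `ϖ` of `R`;
* `val_algebraMap_le_pow_iff_dvd`, `exists_limit_of_forall_val_sub_le_pow` — (iv): `ϖ`-adically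
  Cauchy sequences of `L` converge when `R` is `𝔪`-adically complete (Mathlib `IsAdicComplete`);
* `exists_mem_kernel_zCoord_eq` — (iii): for `R` henselian and `X ⊗ L` elliptic, every `a` with
  `|a| < 1` is `z(P)` for a point `P ∈ E₁(L)` (Silverman *AEC* VII.2.2: `z : E₁ → 𝔪` is onto;
  transcription of the tree's `exists_mem_kernel_zCoord_eq` (`UnramifiedCoboundaryInputs`, over
  `K̄_v`) without its Galois-invariance clause: the monic cubic of `FormalGroupChart.approxRoot`
  and Hensel's lemma in `R`);
* `map_val_top_surjective` — every point of `X ⊗ L` comes from the layer `⊤`.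

References (locators only; no new fact): [cite: MilneADT2006, Ch. I Prop. 3.8 (proof)]
[cite: SilvermanAEC2009, IV.1, Prop. VII.2.2 (PDF pp. 115–118, 191)]
[cite: SerreLocalFields1979, V §2, XIII §1].

## Design

No definitions; `noncomputable section`; `open scoped Classical NNReal`; `w`, `hw` explicit.
Axioms: `propext`, `Classical.choice`, `Quot.sound`.
-/

noncomputable section

open scoped Classical NNReal

namespace Summit.BirchSwinnertonDyer.Rank1Residual.X11b.Three.JetchevKummer

open WeierstrassCurve Literature.NumberTheory.EllipticCurves
  Literature.NumberTheory.EllipticCurves.FormalGroupChart Polynomial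

universe u

variable {F : Type u} [Field F] (X : WeierstrassCurve F) (L : Type u) [Field L] [Algebra F L]
  (R : Type*) [CommRing R] [IsDomain R] [IsDiscreteValuationRing R] [Algebra R L]
  [IsFractionRing R L] (w : Valuation L ℝ≥0) (hw : w.Integers R)

/-! ### §1 Integrality for `𝒪_w` -/

omit [IsDomain R] [IsDiscreteValuationRing R] [IsFractionRing R L] in
include hw in
/-- `X ⊗ L` is `𝒪_w`-integral when it has an `R`-model and `R` is the valuation ring of `w`.
[folklore] -/
theorem isIntegral_integer_of_baseChange_eq (W₀ : WeierstrassCurve R)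
    (hX : X.baseChange L = W₀.baseChange L) : (X.baseChange L).IsIntegral w.integer := by
  let ι : R →+* w.integer :=
    { toFun := fun r ↦ ⟨algebraMap R L r, hw.map_le_one r⟩
      map_one' := Subtype.ext (by simp)
      map_mul' := fun a b ↦ Subtype.ext (by simp)
      map_zero' := Subtype.ext (by simp)
      map_add' := fun a b ↦ Subtype.ext (by simp) }
  refine ⟨⟨W₀.map ι, ?_⟩⟩
  rw [hX, WeierstrassCurve.baseChange, WeierstrassCurve.baseChange, WeierstrassCurve.map_map]
  rfl

/-! ### §2 Input (i): discreteness with the uniformiser of `R` -/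

omit [IsFractionRing R L] in
include hw in
/-- **(i) `|x| < 1 ⇒ |x| ≤ |ϖ|`** for a uniformiser `ϖ` of the discrete valuation ring `R` of `w`
(for the unramified `L/K_v` of `JetchevKummerAtP`, `ϖ` comes from `K_v`). [folklore] -/
theorem val_le_val_uniformizer_of_lt_one {ϖ : R} (hϖ : Irreducible ϖ) {x : L} (hx : w x < 1) :
    w x ≤ w (algebraMap R L ϖ) := by
  obtain ⟨r, rfl⟩ := hw.exists_of_le_one hx.le
  have hr : r ∈ IsLocalRing.maximalIdeal R := by
    rw [IsLocalRing.mem_maximalIdeal, mem_nonunits_iff, hw.isUnit_iff_valuation_eq_one]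
    exact hx.ne
  rw [hϖ.maximalIdeal_eq, Ideal.mem_span_singleton] at hr
  obtain ⟨s, rfl⟩ := hr
  rw [map_mul, map_mul]
  exact mul_le_of_le_one_right zero_le (hw.map_le_one s)

/-! ### §3 Input (iv): completeness -/

include hw in
/-- `|r| ≤ |ϖ|ⁿ ↔ ϖⁿ ∣ r` in the discrete valuation ring `R` of `w`. [folklore] -/
theorem val_algebraMap_le_pow_iff_dvd {ϖ : R} (hϖ : Irreducible ϖ) (r : R) (n : ℕ) :
    w (algebraMap R L r) ≤ w (algebraMap R L ϖ) ^ n ↔ ϖ ^ n ∣ r := by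
  have hϖ1 : w (algebraMap R L ϖ) < 1 :=
    lt_of_le_of_ne (hw.map_le_one ϖ) (by
      rw [Ne, ← hw.isUnit_iff_valuation_eq_one]; exact hϖ.not_isUnit)
  have hϖ0 : 0 < w (algebraMap R L ϖ) :=
    (Valuation.pos_iff _).mpr (by
      rw [Ne, map_eq_zero_iff _ (IsFractionRing.injective R L)]; exact hϖ.ne_zero)
  constructor
  · intro h
    by_cases hr0 : r = 0
    · rw [hr0]; exact dvd_zero _
    obtain ⟨m, u, rfl⟩ := IsDiscreteValuationRing.eq_unit_mul_pow_irreducible hr0 hϖ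
    have hu : w (algebraMap R L (u : R)) = 1 := hw.isUnit_iff_valuation_eq_one.mp u.isUnit
    simp only [map_mul, map_pow, hu, one_mul] at h
    have hnm : n ≤ m := by
      by_contra hlt
      rw [not_le] at hlt
      exact absurd h (not_le.mpr (pow_lt_pow_right_of_lt_one₀ hϖ0 hϖ1 hlt))
    exact Dvd.dvd.mul_left (pow_dvd_pow ϖ hnm) _
  · rintro ⟨s, rfl⟩
    simp only [map_mul, map_pow]
    exact mul_le_of_le_one_right zero_le (hw.map_le_one s)

include hw in
/-- **(iv) completeness**: if `R` is `𝔪`-adically complete, every sequence `(x_r)` in `L` with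
`|x_{r+1} − x_r| ≤ |ϖ|^{r+1}` has a limit `y` with `|y − x_r| ≤ |ϖ|^{r+1}` (the differences lie in
`R`; apply Mathlib's `IsPrecomplete` to `x_r − x_0 ∈ R`). [folklore] -/
theorem exists_limit_of_forall_val_sub_le_pow [IsAdicComplete (IsLocalRing.maximalIdeal R) R]
    {ϖ : R} (hϖ : Irreducible ϖ) (x : ℕ → L)
    (hx : ∀ r, w (x (r + 1) - x r) ≤ w (algebraMap R L ϖ) ^ (r + 1)) :
    ∃ y : L, ∀ r, w (y - x r) ≤ w (algebraMap R L ϖ) ^ (r + 1) := by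
  -- the differences `x r − x 0` lie in `R`
  have hdiff : ∀ r, ∃ s : R, algebraMap R L s = x r - x 0 := by
    intro r
    induction r with
    | zero => exact ⟨0, by simp⟩
    | succ r ih =>
      obtain ⟨s, hs⟩ := ih
      obtain ⟨t, ht⟩ := hw.exists_of_le_one
        ((hx r).trans (pow_le_one₀ zero_le (hw.map_le_one ϖ)))
      exact ⟨t + s, by rw [map_add, hs, ht]; ring⟩
  choose s hs using hdiff
  have hstep : ∀ r, ϖ ^ (r + 1) ∣ s (r + 1) - s r := by
    intro r
    rw [← val_algebraMap_le_pow_iff_dvd L R w hw hϖ, map_sub, hs, hs,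
      show x (r + 1) - x 0 - (x r - x 0) = x (r + 1) - x r by ring]
    exact hx r
  have hmod : ∀ {m n}, m ≤ n → ϖ ^ m ∣ s n - s m := by
    intro m n hmn
    induction n, hmn using Nat.le_induction with
    | base => simp
    | succ n hmn ih =>
      have h1 : ϖ ^ m ∣ s (n + 1) - s n :=
        (pow_dvd_pow ϖ (Nat.le_succ_of_le hmn)).trans (hstep n)
      have := dvd_add h1 ih
      rwa [show s (n + 1) - s n + (s n - s m) = s (n + 1) - s m by ring] at this
  have hpow : ∀ k, IsLocalRing.maximalIdeal R ^ k = Ideal.span {ϖ ^ k} := fun k ↦ by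
    rw [hϖ.maximalIdeal_eq, Ideal.span_singleton_pow]
  have hcauchy : ∀ {m n}, m ≤ n →
      s m ≡ s n [SMOD (IsLocalRing.maximalIdeal R ^ m • (⊤ : Submodule R R))] := by
    intro m n hmn
    rw [SModEq.sub_mem, smul_eq_mul, Ideal.mul_top, hpow, Ideal.mem_span_singleton]
    have := hmod hmn
    rwa [← dvd_neg, neg_sub] at this
  obtain ⟨lim, hlim⟩ := IsPrecomplete.prec' s hcauchy
  refine ⟨algebraMap R L lim + x 0, fun r ↦ ?_⟩
  have h1 : ϖ ^ (r + 1) ∣ s (r + 1) - lim := by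
    have := hlim (r + 1)
    rw [SModEq.sub_mem, smul_eq_mul, Ideal.mul_top, hpow, Ideal.mem_span_singleton] at this
    exact this
  have h2 : ϖ ^ (r + 1) ∣ lim - s r := by
    have := dvd_sub (hstep r) h1
    rwa [show s (r + 1) - s r - (s (r + 1) - lim) = lim - s r by ring] at this
  rw [show algebraMap R L lim + x 0 - x r = algebraMap R L (lim - s r) by rw [map_sub, hs]; ring]
  exact (val_algebraMap_le_pow_iff_dvd L R w hw hϖ _ _).mpr h2

/-! ### §4 Input (iii): points of `E₁(L)` with prescribed parameter (Hensel) -/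

include hw in
/-- **(iii) `z : E₁(L) → 𝔪_L` is onto** (Silverman, *AEC* Prop. VII.2.2) for `R` henselian and
`X ⊗ L` an elliptic curve: every `a ∈ L` with `|a| < 1` is the parameter `z(P) = −x/y` of a point
`P = (−a y, y) ∈ E₁(L)`, where `y = v/a³` for the root `v` near `−u` (`u = 1 − a₁a − a₂a²`, a
unit) of the monic cubic `v³ + u v² + (a₃ + a₄ a)a³ v − a₆ a⁶` (`FormalGroupChart.approxRoot`,
`monic_cubic_eval`, `equation_of_root`; Hensel's lemma in `R`). Transcription of the tree's
`exists_mem_kernel_zCoord_eq` (over `K̄_v`) to an abstract henselian `R`.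
[cite: SilvermanAEC2009, Prop. VII.2.2 (PDF p. 191) and IV.1] -/
theorem exists_mem_kernel_zCoord_eq [HenselianRing R (IsLocalRing.maximalIdeal R)]
    [hV : (X.baseChange L).IsIntegral w.integer] [(X.baseChange L).IsElliptic]
    {a : L} (ha : w a < 1) :
    ∃ P ∈ kernel w (X.baseChange L), P.zCoord = a := by
  by_cases ha0 : a = 0
  · exact ⟨0, (kernel w _).zero_mem, by rw [WeierstrassCurve.Affine.Point.zCoord_zero, ha0]⟩
  have ha0' : 0 < w a := (Valuation.pos_iff w).mpr ha0
  have hinj : Function.Injective (algebraMap R L) := IsFractionRing.injective R L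
  set V := X.baseChange L with hVdef
  have ha1 : w a ≤ 1 := ha.le
  have ha₃ : w V.a₃ ≤ 1 := val_a₃_le_one
  have ha₄ : w V.a₄ ≤ 1 := val_a₄_le_one
  have ha₆ : w V.a₆ ≤ 1 := val_a₆_le_one
  -- the coefficients of the monic cubic
  set u : L := 1 - V.a₁ * a - V.a₂ * a ^ 2 with hu
  set c : L := (V.a₃ + V.a₄ * a) * a ^ 3 with hc
  set d : L := V.a₆ * a ^ 6 with hd
  obtain ⟨hu1, happ, huniq⟩ := approxRoot (V := V) (w := w) ha
  have hca : w c ≤ w a ^ 3 := by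
    rw [hc, map_mul, map_pow]
    refine mul_le_of_le_one_left zero_le ?_
    refine (Valuation.map_add w _ _).trans (max_le ha₃ ?_)
    rw [map_mul]; exact mul_le_one' ha₄ ha1
  have ha3lt : w a ^ 3 < 1 := pow_lt_one₀ zero_le ha three_ne_zero
  have hc1 : w c ≤ 1 := hca.trans ha3lt.le
  have hd1 : w d ≤ 1 := by
    rw [hd, map_mul, map_pow]; exact mul_le_one' ha₆ (pow_le_one₀ zero_le ha1)
  -- integral lifts of the coefficients
  obtain ⟨uR, huR⟩ := hw.exists_of_le_one hu1.le
  obtain ⟨cR, hcR⟩ := hw.exists_of_le_one hc1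
  obtain ⟨dR, hdR⟩ := hw.exists_of_le_one hd1
  -- the monic cubic over `R` and its approximate root `-u`
  set f : R[X] := Polynomial.X ^ 3 + C uR * Polynomial.X ^ 2 + C cR * Polynomial.X - C dR
    with hf
  have hfmonic : f.Monic := by
    rw [hf, sub_eq_add_neg, add_assoc, add_assoc]
    refine (monic_X_pow 3).add_of_left ?_
    refine (degree_add_le _ _).trans_lt (max_lt ?_ ((degree_add_le _ _).trans_lt (max_lt ?_ ?_)))
    · exact (degree_C_mul_X_pow_le 2 _).trans_lt (by rw [degree_X_pow]; norm_num)
    · exact (degree_C_mul_X_le _).trans_lt (by rw [degree_X_pow]; norm_num)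
    · rw [degree_neg]; exact (degree_C_le).trans_lt (by rw [degree_X_pow]; norm_num)
  have hfeval : ∀ Y : R, algebraMap R L (f.eval Y) =
      (algebraMap R L Y) ^ 3 + u * (algebraMap R L Y) ^ 2 + c * algebraMap R L Y - d := by
    intro Y
    rw [hf]
    simp only [eval_add, eval_sub, eval_mul, eval_pow, eval_X, eval_C, map_add, map_sub, map_mul,
      map_pow, huR, hcR, hdR, hu]
  have hfder : ∀ Y : R, algebraMap R L (f.derivative.eval Y) =
      3 * (algebraMap R L Y) ^ 2 + 2 * u * algebraMap R L Y + c := by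
    intro Y
    have : f.derivative = 3 * Polynomial.X ^ 2 + 2 * C uR * Polynomial.X + C cR := by
      rw [hf]
      simp only [derivative_add, derivative_sub, derivative_X_pow, derivative_mul, derivative_C,
        derivative_X, zero_mul, zero_add, mul_one, sub_zero, Nat.cast_ofNat, map_ofNat]
      ring
    rw [this]
    simp only [eval_add, eval_mul, eval_pow, eval_X, eval_C, eval_ofNat, map_add, map_mul, map_pow,
      map_ofNat, huR, hcR, hu]
  have h₁ : f.eval (-uR) ∈ IsLocalRing.maximalIdeal R := by
    rw [← IsLocalRing.residue_eq_zero_iff, ← v_algebraMap_lt_one_iff hw, hfeval, map_neg, huR]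
    refine lt_of_le_of_lt (le_trans (le_of_eq ?_) happ) ha3lt
    rw [hu, hc, hd]
  have h₂ : IsUnit (f.derivative.eval (-uR)) := by
    rw [hw.isUnit_iff_valuation_eq_one, hfder, map_neg, huR,
      show (3 : L) * (-u) ^ 2 + 2 * u * -u + c = u ^ 2 + c by ring, Valuation.map_add_eq_of_lt_left]
    · rw [map_pow, hu1, one_pow]
    · rw [map_pow, hu1, one_pow]; exact hca.trans_lt ha3lt
  obtain ⟨Y₀, hY₀root, hY₀cong⟩ := HenselianRing.is_henselian (I := IsLocalRing.maximalIdeal R) f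
    hfmonic (-uR) h₁ (h₂.map _)
  -- `|Y₀| = 1`
  have hY₀1 : w (algebraMap R L Y₀) = 1 := by
    refine huniq _ ?_
    have := hY₀cong
    rw [← IsLocalRing.residue_eq_zero_iff, ← v_algebraMap_lt_one_iff hw, map_sub, map_neg, huR,
      sub_neg_eq_add] at this
    exact this
  -- the point
  have ha3 : a ^ 3 ≠ 0 := pow_ne_zero 3 ha0
  set y : L := algebraMap R L Y₀ / a ^ 3 with hy
  have hYy : algebraMap R L Y₀ = y * a ^ 3 := by rw [hy, div_mul_cancel₀ _ ha3]
  have hrootL : (algebraMap R L Y₀) ^ 3 + u * (algebraMap R L Y₀) ^ 2 + c * algebraMap R L Y₀ - d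
      = 0 := by
    have h := congrArg (algebraMap R L) (show f.eval Y₀ = 0 from hY₀root)
    rwa [hfeval, map_zero] at h
  have hg : a ^ 3 * y ^ 3 + (1 - V.a₁ * a - V.a₂ * a ^ 2) * y ^ 2 + (V.a₃ + V.a₄ * a) * y - V.a₆
      = 0 := by
    have hm := monic_cubic_eval (V := V) a y
    rw [← hYy] at hm
    have h6 : a ^ 6 * (a ^ 3 * y ^ 3 + (1 - V.a₁ * a - V.a₂ * a ^ 2) * y ^ 2 +
        (V.a₃ + V.a₄ * a) * y - V.a₆) = 0 := by
      rw [← hm, ← hrootL, hu, hc, hd]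
    exact (mul_eq_zero.mp h6).resolve_left (pow_ne_zero 6 ha0)
  have heq : V.toAffine.Equation (-a * y) y := equation_of_root hg
  have hns : V.toAffine.Nonsingular (-a * y) y := (Affine.equation_iff_nonsingular).mp heq
  have hwy : w y * w a ^ 3 = 1 := by rw [← map_pow, ← map_mul, ← hYy, hY₀1]
  have hy0 : y ≠ 0 := by
    intro h; rw [h, map_zero, zero_mul] at hwy; exact zero_ne_one hwy
  refine ⟨.some _ _ hns, some_mem_kernel hns (one_lt_val_of_root ha0' ha hwy), ?_⟩
  rw [WeierstrassCurve.Affine.Point.zCoord_some]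
  field_simp

/-! ### §5 The layer `⊤` -/

omit [IsDomain R] [IsDiscreteValuationRing R] [IsFractionRing R L] in
/-- Every point of `X ⊗ L` is the image of a point over the layer `⊤ ⊆ L`. [folklore] -/
theorem map_val_top_surjective (P : (X.baseChange L).toAffine.Point) :
    P ∈ (WeierstrassCurve.Affine.Point.map (W' := X)
      (IntermediateField.val (⊤ : IntermediateField F L))).range := by
  rcases P with _ | ⟨x, y, h⟩
  · exact ⟨0, rfl⟩
  · have h' : (X.baseChange (⊤ : IntermediateField F L)).toAffine.Nonsingular
        (⟨x, IntermediateField.mem_top⟩ : (⊤ : IntermediateField F L))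
        (⟨y, IntermediateField.mem_top⟩ : (⊤ : IntermediateField F L)) :=
      (Affine.baseChange_nonsingular X (IntermediateField.val ⊤).injective _ _).mp h
    exact ⟨.some _ _ h', rfl⟩

end Summit.BirchSwinnertonDyer.Rank1Residual.X11b.Three.JetchevKummer

end
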